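import Literature.NumberTheory.ComplexMultiplication.TateHypEllPowerTowerOfCMElliptic
import Summits.HodgeConjecture.HodgeConjecture.Theorems.HCCMUnconditionalShimuraThm18_6Holds
import HarnessLib

/-!
# T5 §6.4 — Tate's hypothesis along `ℓ`-power towers for CM elliptic structures, UNCONDITIONALLY

Cell hodgecm-mathlib, fan A, binder hLiu418 (item stmt-HodgeConjecture-24832), sub-skeleton
`Cruxes/HLiu418/Lines/faltings_isogeny.lean` (row VI-1 [Fal83 §5 Kor. 1] re-keyed on Tate's
hypothesis along `ℓ`-power towers `AbelianVariety.tateHypEllPowerTower`, FALTINGS-SPEC §6.4 «CM first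
rung»).  The Literature head
`Literature.NumberTheory.ComplexMultiplication.tateHypEllPowerTower_of_CM_elliptic_of_thm18_6` proves the
§6.4 text of record granted the named fact `shimura1998_thm18_6` ([Shimura 1998, Thm. 18.6]); that fact
is a THEOREM of the tree Summits-side (`Theorems.shimura1998_thm18_6_holds`, row II-1), so here the
§6.4 statement is closed with NO hypothesis: for every structure `(A₀, ι₀ : 𝓞_K → End A₀)` of CM type
`(K, Φ)` over a number field `k ⊇ K*` with `[K : ℚ] = 2` (a CM elliptic curve with CM by `𝓞_K`
defined over `k`) and every prime `ℓ`, along every `ℓ`-power isogeny tower onto `A₀` infinitely many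
members are mutually `k`-isomorphic — a decided instance, outside dimension `0`, of the residual
citation `stub_hypEllPowerTower` of the VI-1 line (witness rung; no floor change).  The v4 slot
`stub_tateHypEllPowerTower_of_CM_elliptic` of `faltings_isogeny.lean` closes `:= tateHypEllPowerTower_of_CM_elliptic`.

HC_CM is proved only modulo the printed citations of the floor until rung 0 closes; this file moves
no floor binder.
-/

-- mandated namespace `Summit.HodgeConjecture.HodgeConjecture.Theorems` trips `linter.dupNamespace` (single-problem
-- summit); off as in `HCCMUnconditionalShimuraThm18_6Holds.lean`.
set_option linter.dupNamespace false

open CategoryTheory NumberField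
open scoped NumberField

namespace Summit.HodgeConjecture.HodgeConjecture.Theorems

open Literature.AlgebraicGeometry.Motives
open Literature.NumberTheory.ComplexMultiplication

/-- **Tate's finiteness hypothesis along `ℓ`-power towers for CM elliptic structures over number
fields, unconditionally** (FALTINGS-SPEC §6.4 text of record; Tate 1966 §2 Hyp(k, A, ℓ) decided for
`(A₀, ι₀)` of CM type `(K, Φ)`, `[K : ℚ] = 2`): the Literature head
`tateHypEllPowerTower_of_CM_elliptic_of_thm18_6` (Shimura–Taniyama Frobenius at a degree-one place,
bounded stabiliser index, ideal-class / shape pigeonhole, realising endomorphism) fed with the tree's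
theorem `shimura1998_thm18_6_holds` ([Shimura 1998, Thm. 18.6], row II-1).
[cite: Tate1966Endomorphisms, §2 pp. 136–137] [cite: Shimura1998, §18.6 Theorem 18.6; §7.4 Propositions 15 and 17] -/
theorem tateHypEllPowerTower_of_CM_elliptic :
    ∀ {k : Type} [Field k] [Algebra k ℂ] {K : Type} [Field K] [NumberField K]
      [IsCMField K] (Φ : CMType K) (A₀ : AbelianVariety k) (ι₀ : 𝓞 K →+* End A₀),
      IsCMTypeRealisationOver Φ A₀ ι₀ → Module.finrank ℚ K = 2 →
      ∀ (ℓ : ℕ) [Fact ℓ.Prime], A₀.tateHypEllPowerTower ℓ :=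
  Literature.NumberTheory.ComplexMultiplication.tateHypEllPowerTower_of_CM_elliptic_of_thm18_6
    shimura1998_thm18_6_holds

end Summit.HodgeConjecture.HodgeConjecture.Theorems
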